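import Summits.HubbardSuperconductivity.HubbardSuperconductivity.Theorems.AnisotropyChordTransferFibre3RowDMFormTransform

/-!
# Route `AnisotropyChord` / H0 rotor rung: PartN41-D §3 FACT 2 — `MFormJU` PROVED (the pure-jump spectator monomial vanishes off `D`)

Theory-1 g22's PartN41-D §3 `MFormJU` (port …Fibre3KT2aRow): off `D`, `mform3(f_JU, f_JU, f_JU)(c) = 0`.  With `f_JU = a(1 − δ₀)` the product
`Π_JU` is `a³(1 − 1_D)`, so each bracket of `mform3` is `−a³ ×` an indicator of an entry-into-`D` event; the events pair up under `e ↔ −e`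
with phases `(e^{iθ} − 1) + e^{iθ}(e^{−iθ} − 1) = 0` (★ `mFormJU_holds : MFormJU L Δ`, any `Δ`, `f`, `L ≥ 1`).
Prover seat `hubbard-h0-rotor-p1` g27 (route lead); helper for stmt-HubbardSuperconductivity-23918 (`--supports`, helper class).
WHAT THIS IS NOT: nothing here proves superconductivity in the Hubbard model.  Tree imports only; no new definitions; no sorry.
-/

set_option linter.dupNamespace false
set_option autoImplicit false

noncomputable section

open scoped BigOperators

namespace Summit.HubbardSuperconductivity.HubbardSuperconductivity.Theorems.AnisotropyChord.Transfer.Fibre3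

variable (L : ℕ) [NeZero L]

namespace RowD

omit [NeZero L] in
/-- the value of `Π_JU` off `D`: `a³`. [folklore] -/
theorem prodJU_offD (Δ : ℝ) (f : Tor L → ℝ) (x y : Tor L) (hx : x ≠ 0) (hy : y ≠ 0) (hxy : x ≠ y) :
    fJU L Δ f x * fJU L Δ f y * fJU L Δ f (y - x) = (Δ * f (K1 L)) ^ 3 := by
  have hyx : y - x ≠ 0 := sub_ne_zero.mpr (Ne.symm hxy)
  unfold fJU; rw [if_neg hx, if_neg hy, if_neg hyx]; ring

omit [NeZero L] in
/-- diagonal move: `Π_JU(x−e, y−e) − a³ = −a³([x = e] + [y = e])` off `D`. [folklore] -/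
theorem prodJU_diag (Δ : ℝ) (f : Tor L → ℝ) (x y e : Tor L) (hxy : x ≠ y) :
    fJU L Δ f (x - e) * fJU L Δ f (y - e) * fJU L Δ f ((y - e) - (x - e)) - (Δ * f (K1 L)) ^ 3
      = -(Δ * f (K1 L)) ^ 3 * ((if x = e then 1 else 0) + (if y = e then 1 else 0)) := by
  have hyx : (y - e) - (x - e) ≠ 0 := by rw [sub_sub_sub_cancel_right]; exact sub_ne_zero.mpr (Ne.symm hxy)
  unfold fJU; rw [if_neg hyx]
  by_cases h1 : x = e
  · have h2 : ¬ y = e := fun h => hxy (h1.trans h.symm)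
    rw [if_pos (sub_eq_zero.mpr h1), if_neg (fun h => h2 (sub_eq_zero.mp h)), if_pos h1, if_neg h2]; ring
  · rw [if_neg (fun h => h1 (sub_eq_zero.mp h)), if_neg h1]
    by_cases h2 : y = e
    · rw [if_pos (sub_eq_zero.mpr h2), if_pos h2]; ring
    · rw [if_neg (fun h => h2 (sub_eq_zero.mp h)), if_neg h2]; ring

omit [NeZero L] in
/-- first-coordinate move: `Π_JU(x+e, y) − a³ = −a³([x = −e] + [y = x + e])` (`y ≠ 0`). [folklore] -/
theorem prodJU_move1 (Δ : ℝ) (f : Tor L → ℝ) (x y e : Tor L) (hy : y ≠ 0) :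
    fJU L Δ f (x + e) * fJU L Δ f y * fJU L Δ f (y - (x + e)) - (Δ * f (K1 L)) ^ 3
      = -(Δ * f (K1 L)) ^ 3 * ((if x = -e then 1 else 0) + (if y = x + e then 1 else 0)) := by
  unfold fJU; rw [if_neg hy]
  have c1 : (x + e = 0) ↔ (x = -e) := by rw [add_eq_zero_iff_eq_neg]
  have c2 : (y - (x + e) = 0) ↔ (y = x + e) := sub_eq_zero
  by_cases h1 : x = -e
  · have h2 : ¬ y = x + e := fun h => hy (by rw [h, h1, neg_add_cancel])
    rw [if_pos (c1.mpr h1), if_neg (fun h => h2 (c2.mp h)), if_pos h1, if_neg h2]; ring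
  · rw [if_neg (fun h => h1 (c1.mp h)), if_neg h1]
    by_cases h2 : y = x + e
    · rw [if_pos (c2.mpr h2), if_pos h2]; ring
    · rw [if_neg (fun h => h2 (c2.mp h)), if_neg h2]; ring

omit [NeZero L] in
/-- second-coordinate move: `Π_JU(x, y+e) − a³ = −a³([y = −e] + [y = x + (−e)])` (`x ≠ 0`). [folklore] -/
theorem prodJU_move2 (Δ : ℝ) (f : Tor L → ℝ) (x y e : Tor L) (hx : x ≠ 0) :
    fJU L Δ f x * fJU L Δ f (y + e) * fJU L Δ f ((y + e) - x) - (Δ * f (K1 L)) ^ 3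
      = -(Δ * f (K1 L)) ^ 3 * ((if y = -e then 1 else 0) + (if y = x + -e then 1 else 0)) := by
  unfold fJU; rw [if_neg hx]
  have c1 : (y + e = 0) ↔ (y = -e) := by rw [add_eq_zero_iff_eq_neg]
  have c2 : ((y + e) - x = 0) ↔ (y = x + -e) := by
    rw [sub_eq_zero]; constructor
    · intro h; rw [← h, add_neg_cancel_right]
    · intro h; rw [h, add_assoc, neg_add_cancel, add_zero]
  by_cases h1 : y = -e
  · have h2 : ¬ y = x + -e := fun h => hx (by
      have := h1.symm.trans h
      exact (add_eq_right.mp this.symm))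
    rw [if_pos (c1.mpr h1), if_neg (fun h => h2 (c2.mp h)), if_pos h1, if_neg h2]; ring
  · rw [if_neg (fun h => h1 (c1.mp h)), if_neg h1]
    by_cases h2 : y = x + -e
    · rw [if_pos (c2.mpr h2), if_pos h2]; ring
    · rw [if_neg (fun h => h2 (c2.mp h)), if_neg h2]; ring

omit [NeZero L] in
/-- indicator normalisation: `[x = e]·φ(x) = [x = e]·φ(e)`. [folklore] -/
theorem ind_phase (x e : Tor L) :
    (if x = e then (1 : ℂ) else 0) * phase L (K1 L) x = (if x = e then (1 : ℂ) else 0) * phase L (K1 L) e := by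
  split_ifs with h
  · rw [h]
  · simp

/-- indicator normalisation on a shifted event: `[y = x + e]·φ(y) = [y = x + e]·φ(x)φ(e)`. [folklore] -/
theorem ind_phase_shift (x y e : Tor L) :
    (if y = x + e then (1 : ℂ) else 0) * phase L (K1 L) y = (if y = x + e then (1 : ℂ) else 0) * (phase L (K1 L) x * phase L (K1 L) e) := by
  split_ifs with h
  · rw [h, phase_add]
  · simp

end RowD

/-- ★ **`MFormJU L Δ` holds** (FACT 2). [folklore] -/
theorem mFormJU_holds (Δ : ℝ) : MFormJU L Δ := by
  intro f _hL c hc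
  obtain ⟨x, y⟩ := c
  have hc' := hc
  unfold InD at hc'
  simp only [Bool.or_eq_false_iff, decide_eq_false_iff_not] at hc'
  obtain ⟨⟨hx, hy⟩, hxy⟩ := hc'
  unfold mform3 prod3
  simp only [List.map_cons, List.map_nil, List.sum_cons, List.sum_nil, add_zero]
  rw [RowD.prodJU_offD L Δ f x y hx hy hxy,
    RowD.prodJU_diag L Δ f x y (ex L) hxy, RowD.prodJU_diag L Δ f x y (-ex L) hxy,
    RowD.prodJU_move1 L Δ f x y (ex L) hy, RowD.prodJU_move1 L Δ f x y (-ex L) hy,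
    RowD.prodJU_move2 L Δ f x y (ex L) hx, RowD.prodJU_move2 L Δ f x y (-ex L) hx]
  simp only [neg_neg]
  have r0 : ∀ (P : Prop) [Decidable P], ((if P then 1 else 0 : ℝ) : ℂ) = (if P then (1 : ℂ) else 0) := by
    intro P _; split_ifs <;> simp
  push_cast
  simp only [r0]
  have nA1 := RowD.ind_phase L x (ex L)
  have nA2 := RowD.ind_phase L x (-ex L)
  have nB1 := RowD.ind_phase L y (ex L)
  have nB2 := RowD.ind_phase L y (-ex L)
  have nC1 := RowD.ind_phase_shift L x y (ex L)
  have nC2 := RowD.ind_phase_shift L x y (-ex L)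
  have hmul := phase_mul_neg L (K1 L) (ex L)
  set u := phase L (K1 L) (ex L)
  set v := phase L (K1 L) (-ex L)
  set a3 : ℂ := ((Δ : ℂ) * (f (K1 L) : ℂ)) ^ 3
  set A1 : ℂ := if x = ex L then 1 else 0
  set A2 : ℂ := if x = -ex L then 1 else 0
  set B1 : ℂ := if y = ex L then 1 else 0
  set B2 : ℂ := if y = -ex L then 1 else 0
  set C1 : ℂ := if y = x + ex L then 1 else 0
  set C2 : ℂ := if y = x + -ex L then 1 else 0
  linear_combination ((1 / 2 : ℂ) * a3 * (u - 1)) * nA2 + ((1 / 2 : ℂ) * a3 * (u - 1)) * nB2 + ((1 / 2 : ℂ) * a3 * (u - 1)) * nC2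
    + ((1 / 2 : ℂ) * a3 * (v - 1)) * nA1 + ((1 / 2 : ℂ) * a3 * (v - 1)) * nB1 + ((1 / 2 : ℂ) * a3 * (v - 1)) * nC1
    + ((1 / 2 : ℂ) * a3 * (A1 + B1 + A2 + B2 + phase L (K1 L) x * (C1 + C2))) * hmul

end Summit.HubbardSuperconductivity.HubbardSuperconductivity.Theorems.AnisotropyChord.Transfer.Fibre3

end
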